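import Summits.AtomisticToContinuum.HydrodynamicLimit.Theorems.TwoClocksEquilibriumFastWindowLDBirthT12SectorEquations
import Summits.AtomisticToContinuum.HydrodynamicLimit.Theorems.TwoClocksEquilibriumFastWindowLDBirthT12GainRadialGrowthB
import Summits.AtomisticToContinuum.HydrodynamicLimit.Theorems.TwoClocksEquilibriumFastWindowLDBirthT12EulerGrowth
import HarnessLib

/-!
# T1 in the zonal sector `ℓ = 0`, I: the exact Euler–Volterra defect of the zonal profile and round 1 of the
# bootstrap (helper `t12_zonal_round1` of the line `birth`, crux `TwoClocks.EquilibriumFastWindowLD`,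
# stmt-AtomisticToContinuum-14440; §5 ASSEMBLY, sector `ℓ = 0`, of the registered analytic sub-goal
# `t12_logLinearPreimage_and_dipoleModulus`)

Item T1 of the sub-goal asks that the orthogonal Chapman–Enskog pre-image `ψ₀ = L⁻¹g` of admissible
quadratic data (`|g| ≤ C_g(1+|v|²)`, `g ⊥_M` the collision invariants) be, after the shift by the energy
invariant `-q(|v|² - 3)`, of size `O(C_g(1+|v|) log)` uniformly in the support radius. In the zonal sector this
is the statement `Π₀ψ₀ = q|v|² + O(C_g(1+|v|))`, `|q| ≲ C_g`, and every ingredient is in the tree: the exact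
sector equation `ν f = K₂f - K₁f - Π₀g` for `f := Π₀ψ₀` (`sectorEquation_zonalAvg`, `…T12SectorEquations`),
the a-priori class `|ψ₀| ≤ C C_g(1+|v|²)(1+log(1+|v|²))` (`t12_logQuadraticPreimage_of_quadraticData`), the
far-field gain comparisons on radial functions (`abs_gainTerm_radial_sub_lorentzGain_le_quadLog/…logLinear`,
`…T12GainRadialGrowthB`), the Lorentz action `lorentzGain (F∘‖·‖)(se) = (4π/s)∫₀ˢ tF` (`lorentzGain_radial`),
the loss asymptotics `|K₁f| ≤ π/(2|v|)∫|w|²|f| dM` for `f ⊥_M 1, v` (`abs_lossTerm_le_of_orthogonal`), the rate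
`πs ≤ ν ≤ π(s + 3/(2s))` (`t12_collisionFrequency_le_pi`), the energy identity `K₂|·|² - K₁|·|² = ν|v|²`
(`…T12EnergyAction`) and the Euler–Volterra lemmas with growing defects (`…T12EulerGrowth`). This file and its
sibling `…T12ZonalT1B` do the bookkeeping, for a general continuous PROFILE `F` (`f = F ∘ ‖·‖`) of the
quadratic-log class satisfying the zonal equation along a ray `s ↦ s e`:

* real-variable comparisons of the three weights `(1+s²)(1+log(1+s²))`, `(1+s)(1+log(1+s))`, `1+s`;
* `abs_lossTerm_le_of_quartic` — (e-K₁) on the zonal class: `|K₁u(v)| ≤ π/(2|v|)·m J₆`, `J₆ = ∫(1+|w|)⁶dM`,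
  for `|u| ≤ m(1+|·|)⁴`, `u ⊥_M` the invariants;
* `abs_zonalEulerDefect_le` — the EXACT Euler–Volterra form: with `δ(s) := (4/s²)∫₀ˢ tF - F(s)` (so that
  `F = (4/s²)∫₀ˢtF - δ` identically), the sector equation gives
  `πs δ(s) = (lorentz - K₂)(F∘‖·‖)(se) + K₁(F∘‖·‖)(se) + G(s) + (ν(se) - πs)F(s)`;
* `abs_zonalEulerDefect_le_linLog` — ROUND 1 defect: in the quadratic-log class (constant `m`) with data
  `|G| ≤ C_g(1+s²)`, `|δ(s)| ≤ Γ₁(1+s)(1+log(1+s))` on `[1, ∞)`, `Γ₁ = (5638 + J₆)m + C_g`;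
* the registered **`t12_zonal_round1`** — `t12_euler_zonal_linLogGrowth` (`a = 0`, `s₀ = 1`) then gives `q₁`,
  `|q₁| ≤ 16m + 32Γ₁`, with the GLOBAL lin-log remainder `|F(t) - q₁t²| ≤ (9Γ₁ + 4m + |q₁|)(1+t)(1+log(1+t))`.

Round 2 (peeling off `q₁s²` exactly by the energy identity, a LINEAR defect, `euler_zonal_powGrowth` with
`p = 1`) and the packaging for `ψ₀` are in `…T12ZonalT1B` (`t12_zonal_T1`). All constants are absolute
(generous numerics, the finite Gaussian moment `J₆`). [folklore] (Grad 1963 §4; Cercignani–Illner–Pulvirenti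
1994 §7.2; the corrector-growth plan of the line `birth`, §5.)
-/

noncomputable section

open MeasureTheory ProbabilityTheory Real Set Filter Metric
open scoped ENNReal BigOperators InnerProductSpace

namespace Summit.AtomisticToContinuum.HydrodynamicLimit.Theorems.ClampedCorrectorBirth

open Literature.Analysis.FluidPDE Literature.MathematicalPhysics.KineticTheory
open Literature.Analysis.UnboundedOperators

/-! ### Real-variable inequalities between the weights of the bootstrap -/

/-- `1 + log(1+s²) ≤ 2(1 + log(1+s))` for `0 ≤ s` (`1 + s² ≤ (1+s)²`). [folklore] -/
theorem one_add_log_one_add_sq_le_two_mul {s : ℝ} (hs : 0 ≤ s) :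
    1 + Real.log (1 + s ^ 2) ≤ 2 * (1 + Real.log (1 + s)) := by
  have h1 : Real.log (1 + s ^ 2) ≤ Real.log ((1 + s) ^ 2) :=
    Real.log_le_log (by positivity) (by nlinarith)
  rw [Real.log_pow] at h1
  push_cast at h1
  linarith [Real.log_nonneg (by linarith : (1:ℝ) ≤ 1 + s)]

/-- The quadratic-log weight against the lin-log weight: for `1 ≤ s`,
`(1+s²)(1 + log(1+s²)) ≤ 4s · (1+s)(1 + log(1+s))`. [folklore] -/
theorem quadLog_le_mul_linLog {s : ℝ} (hs : 1 ≤ s) :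
    (1 + s ^ 2) * (1 + Real.log (1 + s ^ 2)) ≤ 4 * s * ((1 + s) * (1 + Real.log (1 + s))) := by
  have hL := one_add_log_one_add_sq_le_two_mul (by linarith : (0:ℝ) ≤ s)
  have h1 : 1 + s ^ 2 ≤ 2 * s * (1 + s) := by nlinarith
  have h2 : 0 ≤ 1 + Real.log (1 + s ^ 2) := by
    linarith [Real.log_nonneg (by nlinarith : (1:ℝ) ≤ 1 + s ^ 2)]
  calc (1 + s ^ 2) * (1 + Real.log (1 + s ^ 2)) ≤ (2 * s * (1 + s)) * (2 * (1 + Real.log (1 + s))) :=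
        mul_le_mul h1 hL h2 (by positivity)
    _ = 4 * s * ((1 + s) * (1 + Real.log (1 + s))) := by ring

/-- The lin-log weight against the linear one: for `1 ≤ s`, `(1+s)(1 + log(1+s)) ≤ 2s(1+s)`. [folklore] -/
theorem linLog_le_mul_linear {s : ℝ} (hs : 1 ≤ s) :
    (1 + s) * (1 + Real.log (1 + s)) ≤ 2 * s * (1 + s) := by
  have h := Real.log_le_sub_one_of_pos (by linarith : (0:ℝ) < 1 + s)
  nlinarith

/-- `1 + s ≤ (1+s)(1 + log(1+s))` and `1 ≤ (1+s)(1 + log(1+s))` for `0 ≤ s`. [folklore] -/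
theorem one_add_le_linLog {s : ℝ} (hs : 0 ≤ s) :
    1 + s ≤ (1 + s) * (1 + Real.log (1 + s)) ∧ 1 ≤ (1 + s) * (1 + Real.log (1 + s)) := by
  have h := one_le_one_add_log_one_add hs
  constructor <;> nlinarith

/-- Small speeds: `(1+t²)(1 + log(1+t²)) ≤ 4` for `0 ≤ t ≤ 1`. [folklore] -/
theorem quadLog_le_four {t : ℝ} (ht0 : 0 ≤ t) (ht : t ≤ 1) :
    (1 + t ^ 2) * (1 + Real.log (1 + t ^ 2)) ≤ 4 := by
  have h := Real.log_le_sub_one_of_pos (by positivity : (0:ℝ) < 1 + t ^ 2)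
  have ht2 : t ^ 2 ≤ 1 := by nlinarith
  have hL0 : 0 ≤ Real.log (1 + t ^ 2) := Real.log_nonneg (by nlinarith)
  nlinarith

/-- The quadratic-log weight is quartic and of Gaussian growth: `(1+t²)(1 + log(1+t²)) ≤ (1+t)⁴` for `0 ≤ t`
and `≤ 32 e^{t²/4}` for all `t`. [folklore] -/
theorem quadLog_le_pow_four_and_exp (t : ℝ) :
    (0 ≤ t → (1 + t ^ 2) * (1 + Real.log (1 + t ^ 2)) ≤ (1 + t) ^ 4) ∧
      (1 + t ^ 2) * (1 + Real.log (1 + t ^ 2)) ≤ 32 * Real.exp (t ^ 2 / 4) := by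
  have h := Real.log_le_sub_one_of_pos (by positivity : (0:ℝ) < 1 + t ^ 2)
  have hL0 : 0 ≤ Real.log (1 + t ^ 2) := Real.log_nonneg (by nlinarith)
  have hsq : (1 + t ^ 2) * (1 + Real.log (1 + t ^ 2)) ≤ (1 + t ^ 2) ^ 2 := by nlinarith
  refine ⟨fun ht => hsq.trans ?_, hsq.trans (one_add_sq_sq_le_exp t)⟩
  have h1 : 1 + t ^ 2 ≤ (1 + t) ^ 2 := by nlinarith
  calc (1 + t ^ 2) ^ 2 ≤ ((1 + t) ^ 2) ^ 2 := pow_le_pow_left₀ (by positivity) h1 2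
    _ = (1 + t) ^ 4 := by ring

/-! ### The zonal profile class: consequences of the quadratic-log a-priori bound -/

variable {F : ℝ → ℝ} {m : ℝ}

/-- A profile `F` with `|F t| ≤ m(1+t²)(1 + log(1+t²))` has `0 ≤ m`, `|F ∘ ‖·‖| ≤ m(1 + ‖·‖)⁴`,
Gaussian growth `32m`, and `|F| ≤ 4m` on `[0, 1]`. [folklore] -/
theorem zonalProfile_apriori (hFW : ∀ t, |F t| ≤ m * (1 + t ^ 2) * (1 + Real.log (1 + t ^ 2))) :
    0 ≤ m ∧ (∀ x : EuclideanSpace ℝ (Fin 3), |F ‖x‖| ≤ m * (1 + ‖x‖) ^ 4) ∧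
      (∀ x : EuclideanSpace ℝ (Fin 3), |F ‖x‖| ≤ 32 * m * Real.exp (‖x‖ ^ 2 / 4)) ∧
      ∀ t, 0 ≤ t → t ≤ 1 → |F t| ≤ 4 * m := by
  have hm : 0 ≤ m := by have h := hFW 0; norm_num at h; exact (abs_nonneg _).trans h
  refine ⟨hm, fun x => ?_, fun x => ?_, fun t ht0 ht1 => ?_⟩
  · have h := (quadLog_le_pow_four_and_exp ‖x‖).1 (norm_nonneg x)
    calc |F ‖x‖| ≤ m * (1 + ‖x‖ ^ 2) * (1 + Real.log (1 + ‖x‖ ^ 2)) := hFW _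
      _ = m * ((1 + ‖x‖ ^ 2) * (1 + Real.log (1 + ‖x‖ ^ 2))) := by ring
      _ ≤ m * (1 + ‖x‖) ^ 4 := mul_le_mul_of_nonneg_left h hm
  · have h := (quadLog_le_pow_four_and_exp ‖x‖).2
    calc |F ‖x‖| ≤ m * (1 + ‖x‖ ^ 2) * (1 + Real.log (1 + ‖x‖ ^ 2)) := hFW _
      _ = m * ((1 + ‖x‖ ^ 2) * (1 + Real.log (1 + ‖x‖ ^ 2))) := by ring
      _ ≤ m * (32 * Real.exp (‖x‖ ^ 2 / 4)) := mul_le_mul_of_nonneg_left h hm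
      _ = 32 * m * Real.exp (‖x‖ ^ 2 / 4) := by ring
  · have h := quadLog_le_four ht0 ht1
    calc |F t| ≤ m * (1 + t ^ 2) * (1 + Real.log (1 + t ^ 2)) := hFW _
      _ = m * ((1 + t ^ 2) * (1 + Real.log (1 + t ^ 2))) := by ring
      _ ≤ m * 4 := mul_le_mul_of_nonneg_left h hm
      _ = 4 * m := by ring

/-- `|∫₀¹ t F(t) dt| ≤ 4m` for a continuous profile of the class. [folklore] -/
theorem abs_firstMoment_one_le_of_quadLog
    (hFW : ∀ t, |F t| ≤ m * (1 + t ^ 2) * (1 + Real.log (1 + t ^ 2))) :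
    |∫ t in (0:ℝ)..1, t * F t| ≤ 4 * m := by
  obtain ⟨hm, -, -, h4⟩ := zonalProfile_apriori hFW
  have h := intervalIntegral.norm_integral_le_of_norm_le_const (a := (0:ℝ)) (b := 1) (C := 4 * m)
    (f := fun t => t * F t) fun t ht => by
      rw [uIoc_of_le zero_le_one] at ht
      rw [Real.norm_eq_abs, abs_mul, abs_of_nonneg ht.1.le]
      calc t * |F t| ≤ 1 * (4 * m) := mul_le_mul ht.2 (h4 t ht.1.le ht.2) (abs_nonneg _) zero_le_one
        _ = 4 * m := one_mul _
  rw [Real.norm_eq_abs] at h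
  simpa using h

/-- **(e-K₁) on the zonal class**: for `u` measurable with `|u| ≤ m(1 + ‖·‖)⁴`, `u ⊥_M` the collision
invariants and `v ≠ 0`, `|K₁u(v)| ≤ π/(2‖v‖) · m ∫ (1 + ‖w‖)⁶ dM` (`abs_lossTerm_le_of_orthogonal`; the sixth
moment is finite, `integrable_one_add_norm_pow_stdGaussian`). [folklore] -/
theorem abs_lossTerm_le_of_quartic {u : EuclideanSpace ℝ (Fin 3) → ℝ} (hu : Measurable u)
    (hm : ∀ x, |u x| ≤ m * (1 + ‖x‖) ^ 4)
    (horth : ∀ φ ∈ collisionInvariants (EuclideanSpace ℝ (Fin 3)), maxwellianInner u φ = 0)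
    {v : EuclideanSpace ℝ (Fin 3)} (hv : v ≠ 0) :
    |lossTerm u v| ≤ π / (2 * ‖v‖) *
      (m * ∫ w, (1 + ‖w‖) ^ 6 ∂stdGaussian (EuclideanSpace ℝ (Fin 3))) := by
  have h1 : ∀ x : EuclideanSpace ℝ (Fin 3), |(fun _ : EuclideanSpace ℝ (Fin 3) => (1:ℝ)) x| ≤
      1 * Real.exp (‖x‖ ^ 2 / 4) := fun x => by
    rw [abs_one, one_mul]; exact Real.one_le_exp (by positivity)
  have hi : Integrable u (stdGaussian (EuclideanSpace ℝ (Fin 3))) := by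
    have := integrable_mul_of_gaussGrowth_of_polyGrowth measurable_const hu h1 hm
    simpa only [one_mul] using this
  have hsq : ∀ x : EuclideanSpace ℝ (Fin 3), |‖x‖ ^ 2 * u x| ≤ m * (1 + ‖x‖) ^ 6 := fun x => by
    rw [abs_mul, abs_of_nonneg (sq_nonneg _)]
    have h2 : ‖x‖ ^ 2 ≤ (1 + ‖x‖) ^ 2 := by nlinarith [norm_nonneg x]
    calc ‖x‖ ^ 2 * |u x| ≤ (1 + ‖x‖) ^ 2 * (m * (1 + ‖x‖) ^ 4) :=
          mul_le_mul h2 (hm x) (abs_nonneg _) (by positivity)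
      _ = m * (1 + ‖x‖) ^ 6 := by ring
  have hsqm : Measurable fun w : EuclideanSpace ℝ (Fin 3) => ‖w‖ ^ 2 * u w :=
    (continuous_norm.pow 2).measurable.mul hu
  have hi2 : Integrable (fun w => ‖w‖ ^ 2 * u w) (stdGaussian (EuclideanSpace ℝ (Fin 3))) := by
    have := integrable_mul_of_gaussGrowth_of_polyGrowth measurable_const hsqm h1 hsq
    simpa only [one_mul] using this
  unfold lossTerm
  refine (abs_lossTerm_le_of_orthogonal hi hi2 horth hv).trans (mul_le_mul_of_nonneg_left ?_ (by positivity))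
  calc ∫ w, ‖w‖ ^ 2 * |u w| ∂stdGaussian (EuclideanSpace ℝ (Fin 3))
      = ∫ w, |‖w‖ ^ 2 * u w| ∂stdGaussian (EuclideanSpace ℝ (Fin 3)) := by
        refine integral_congr_ae (Eventually.of_forall fun w => ?_)
        simp only [abs_mul, abs_pow, abs_norm]
    _ ≤ ∫ w, m * (1 + ‖w‖) ^ 6 ∂stdGaussian (EuclideanSpace ℝ (Fin 3)) :=
        integral_mono hi2.abs ((integrable_one_add_norm_pow_stdGaussian 6).const_mul m) hsq
    _ = m * ∫ w, (1 + ‖w‖) ^ 6 ∂stdGaussian (EuclideanSpace ℝ (Fin 3)) := integral_const_mul _ _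

/-! ### The exact Euler–Volterra defect of the zonal profile -/

/-- `lorentzGain (F ∘ ‖·‖)(s e) = (4π/s) ∫₀ˢ t F(t) dt` for `s > 0` and a unit vector `e`. [folklore] -/
theorem lorentzGain_profile (hFm : Measurable F) (e : sphere (0 : EuclideanSpace ℝ (Fin 3)) 1) {s : ℝ}
    (hs : 0 < s) :
    lorentzGain (fun x : EuclideanSpace ℝ (Fin 3) => F ‖x‖) (s • (e : EuclideanSpace ℝ (Fin 3))) =
      4 * π / s * ∫ t in (0:ℝ)..s, t * F t := by
  rw [lorentzGain_radial _ hFm, norm_smul_sphere, abs_of_pos hs, lorentzRadial_eq_div_mul_integral F hs]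

/-- **The exact Euler–Volterra form of the zonal sector equation.** With `u = F ∘ ‖·‖`, `v = s e`, `s > 0`:
if `ν(v) F(s) = K₂u(v) - K₁u(v) - G` then
`π s ((4/s²)∫₀ˢ tF - F(s)) = (lorentz u - K₂u)(v) + K₁u(v) + G + (ν(v) - πs) F(s)`, so that
`F(s) = (4/s²)∫₀ˢ tF - δ(s)` with `|πs δ(s)| ≤ |K₂u - lorentz u| + |K₁u| + |G| + (ν - πs)|F(s)|`. [folklore] -/
theorem abs_zonalEulerDefect_le (hFm : Measurable F) (e : sphere (0 : EuclideanSpace ℝ (Fin 3)) 1) {s G : ℝ}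
    (hs : 0 < s)
    (hS : collisionFrequency (s • (e : EuclideanSpace ℝ (Fin 3))) * F s =
      gainTerm (fun x : EuclideanSpace ℝ (Fin 3) => F ‖x‖) (s • (e : EuclideanSpace ℝ (Fin 3))) -
        lossTerm (fun x : EuclideanSpace ℝ (Fin 3) => F ‖x‖) (s • (e : EuclideanSpace ℝ (Fin 3))) - G) :
    |π * s * (4 / s ^ 2 * (∫ t in (0:ℝ)..s, t * F t) - F s)| ≤
      |gainTerm (fun x : EuclideanSpace ℝ (Fin 3) => F ‖x‖) (s • (e : EuclideanSpace ℝ (Fin 3))) -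
          lorentzGain (fun x : EuclideanSpace ℝ (Fin 3) => F ‖x‖) (s • (e : EuclideanSpace ℝ (Fin 3)))| +
        |lossTerm (fun x : EuclideanSpace ℝ (Fin 3) => F ‖x‖) (s • (e : EuclideanSpace ℝ (Fin 3)))| + |G| +
        (collisionFrequency (s • (e : EuclideanSpace ℝ (Fin 3))) - π * s) * |F s| ∧
      0 ≤ collisionFrequency (s • (e : EuclideanSpace ℝ (Fin 3))) - π * s ∧
      (collisionFrequency (s • (e : EuclideanSpace ℝ (Fin 3))) - π * s) * s ≤ 3 * π / 2 := by
  set v : EuclideanSpace ℝ (Fin 3) := s • (e : EuclideanSpace ℝ (Fin 3)) with hv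
  have hvn : ‖v‖ = s := by rw [hv, norm_smul_sphere, abs_of_pos hs]
  have hν0 : 0 ≤ collisionFrequency v - π * s := by
    have h := pi_mul_norm_le_collisionFrequency v
    rw [hvn] at h
    linarith
  have hν1 : (collisionFrequency v - π * s) * s ≤ 3 * π / 2 := by
    have h := t12_collisionFrequency_le_pi v
    rw [hvn] at h
    nlinarith
  refine ⟨?_, hν0, hν1⟩
  have h1 : π * s * (4 / s ^ 2 * ∫ t in (0:ℝ)..s, t * F t) =
      lorentzGain (fun x : EuclideanSpace ℝ (Fin 3) => F ‖x‖) v := by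
    rw [lorentzGain_profile hFm e hs]
    field_simp
  have key : π * s * (4 / s ^ 2 * (∫ t in (0:ℝ)..s, t * F t) - F s) =
      (lorentzGain (fun x : EuclideanSpace ℝ (Fin 3) => F ‖x‖) v -
          gainTerm (fun x : EuclideanSpace ℝ (Fin 3) => F ‖x‖) v) +
        lossTerm (fun x : EuclideanSpace ℝ (Fin 3) => F ‖x‖) v + G + (collisionFrequency v - π * s) * F s := by
    linear_combination h1 - hS
  rw [key]
  have e1 : |(collisionFrequency v - π * s) * F s| = (collisionFrequency v - π * s) * |F s| := by
    rw [abs_mul, abs_of_nonneg hν0]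
  calc _ ≤ |lorentzGain (fun x : EuclideanSpace ℝ (Fin 3) => F ‖x‖) v -
          gainTerm (fun x : EuclideanSpace ℝ (Fin 3) => F ‖x‖) v +
        lossTerm (fun x : EuclideanSpace ℝ (Fin 3) => F ‖x‖) v + G| + |(collisionFrequency v - π * s) * F s| :=
        abs_add_le _ _
    _ ≤ |lorentzGain (fun x : EuclideanSpace ℝ (Fin 3) => F ‖x‖) v -
          gainTerm (fun x : EuclideanSpace ℝ (Fin 3) => F ‖x‖) v +
        lossTerm (fun x : EuclideanSpace ℝ (Fin 3) => F ‖x‖) v| + |G| + |(collisionFrequency v - π * s) * F s| := by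
        gcongr; exact abs_add_le _ _
    _ ≤ |lorentzGain (fun x : EuclideanSpace ℝ (Fin 3) => F ‖x‖) v -
          gainTerm (fun x : EuclideanSpace ℝ (Fin 3) => F ‖x‖) v| +
        |lossTerm (fun x : EuclideanSpace ℝ (Fin 3) => F ‖x‖) v| + |G| + |(collisionFrequency v - π * s) * F s| := by
        gcongr; exact abs_add_le _ _
    _ = _ := by rw [e1, abs_sub_comm]

/-! ### Round 1: the quadratic-log class has a lin-log Euler defect -/

/-- **Round-1 defect bound.** If `|F| ≤ m(1+t²)(1+log(1+t²))`, `F ∘ ‖·‖ ⊥_M` the collision invariants,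
`|G| ≤ C_g(1+s²)` and the zonal sector equation `ν(se) F(s) = K₂(F∘‖·‖)(se) - K₁(F∘‖·‖)(se) - G` holds at
`s ≥ 1`, then `|(4/s²)∫₀ˢ tF - F(s)| ≤ Γ₁ (1+s)(1+log(1+s))` with `Γ₁ = (5638 + J₆) m + C_g`,
`J₆ = ∫ (1+‖w‖)⁶ dM` ((e-K₂) quad-log `1408π`, (e-K₁) `π m J₆/2`, data `C_g(1+s²)`, (e-ν) `3π/2`). [folklore] -/
theorem abs_zonalEulerDefect_le_linLog (hFm : Measurable F)
    (hFW : ∀ t, |F t| ≤ m * (1 + t ^ 2) * (1 + Real.log (1 + t ^ 2)))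
    (horth : ∀ φ ∈ collisionInvariants (EuclideanSpace ℝ (Fin 3)),
      maxwellianInner (fun x : EuclideanSpace ℝ (Fin 3) => F ‖x‖) φ = 0)
    (e : sphere (0 : EuclideanSpace ℝ (Fin 3)) 1) {Cg s G : ℝ} (hCg : 0 ≤ Cg) (hs : 1 ≤ s)
    (hG : |G| ≤ Cg * (1 + s ^ 2))
    (hS : collisionFrequency (s • (e : EuclideanSpace ℝ (Fin 3))) * F s =
      gainTerm (fun x : EuclideanSpace ℝ (Fin 3) => F ‖x‖) (s • (e : EuclideanSpace ℝ (Fin 3))) -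
        lossTerm (fun x : EuclideanSpace ℝ (Fin 3) => F ‖x‖) (s • (e : EuclideanSpace ℝ (Fin 3))) - G) :
    |4 / s ^ 2 * (∫ t in (0:ℝ)..s, t * F t) - F s| ≤
      ((5638 + ∫ w, (1 + ‖w‖) ^ 6 ∂stdGaussian (EuclideanSpace ℝ (Fin 3))) * m + Cg) *
        ((1 + s) * (1 + Real.log (1 + s))) := by
  obtain ⟨J, hJ0, hJ⟩ : ∃ J : ℝ, 0 ≤ J ∧ (∫ w, (1 + ‖w‖) ^ 6 ∂stdGaussian (EuclideanSpace ℝ (Fin 3))) = J :=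
    ⟨_, integral_nonneg fun w => by positivity, rfl⟩
  rw [hJ]
  obtain ⟨hm, h4, -, -⟩ := zonalProfile_apriori hFW
  have hs0 : 0 < s := by linarith
  obtain ⟨hdef, hν0, hν1⟩ := abs_zonalEulerDefect_le hFm e hs0 hS
  set v : EuclideanSpace ℝ (Fin 3) := s • (e : EuclideanSpace ℝ (Fin 3)) with hv
  have hvn : ‖v‖ = s := by rw [hv, norm_smul_sphere, abs_of_pos hs0]
  have hv0 : v ≠ 0 := by rw [← norm_ne_zero_iff, hvn]; exact hs0.ne'
  have hQw := quadLog_le_mul_linLog hs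
  obtain ⟨hw1, hw0⟩ := one_add_le_linLog hs0.le
  have hA : |gainTerm (fun x : EuclideanSpace ℝ (Fin 3) => F ‖x‖) v -
      lorentzGain (fun x : EuclideanSpace ℝ (Fin 3) => F ‖x‖) v| ≤
      1408 * π * (m * ((1 + s ^ 2) * (1 + Real.log (1 + s ^ 2)))) := by
    have h := abs_gainTerm_radial_sub_lorentzGain_le_quadLog hFm (fun t _ => hFW t) v
    rw [hvn] at h
    exact h.trans_eq (by ring)
  have hB : |lossTerm (fun x : EuclideanSpace ℝ (Fin 3) => F ‖x‖) v| ≤ π * m * J / 2 := by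
    have h := abs_lossTerm_le_of_quartic (u := fun x : EuclideanSpace ℝ (Fin 3) => F ‖x‖)
      (hFm.comp measurable_norm) h4 horth hv0
    rw [hvn, hJ] at h
    have h2 : π / (2 * s) ≤ π / 2 := div_le_div_of_nonneg_left pi_pos.le two_pos (by linarith)
    calc _ ≤ π / (2 * s) * (m * J) := h
      _ ≤ π / 2 * (m * J) := mul_le_mul_of_nonneg_right h2 (mul_nonneg hm hJ0)
      _ = π * m * J / 2 := by ring
  have hD : (collisionFrequency v - π * s) * |F s| ≤
      3 * π / 2 * (m * ((1 + s ^ 2) * (1 + Real.log (1 + s ^ 2)))) := by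
    have hν2 : collisionFrequency v - π * s ≤ 3 * π / 2 := (le_mul_of_one_le_right hν0 hs).trans hν1
    have hFs : |F s| ≤ m * ((1 + s ^ 2) * (1 + Real.log (1 + s ^ 2))) := (hFW s).trans_eq (by ring)
    exact mul_le_mul hν2 hFs (abs_nonneg _) (by positivity)
  have hπ1 : (1:ℝ) ≤ π := by linarith only [Real.pi_gt_three]
  have t1 : m * ((1 + s ^ 2) * (1 + Real.log (1 + s ^ 2))) ≤
      m * (4 * s * ((1 + s) * (1 + Real.log (1 + s)))) := mul_le_mul_of_nonneg_left hQw hm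
  have t2 : (1:ℝ) ≤ s * ((1 + s) * (1 + Real.log (1 + s))) := one_le_mul_of_one_le_of_one_le hs hw0
  have t3 : 1 + s ^ 2 ≤ s * ((1 + s) * (1 + Real.log (1 + s))) :=
    (by nlinarith only [hs] : 1 + s ^ 2 ≤ s * (1 + s)).trans (mul_le_mul_of_nonneg_left hw1 hs0.le)
  have u1 := mul_le_mul_of_nonneg_left t1 (by positivity : (0:ℝ) ≤ 1408 * π)
  have u0 : (0:ℝ) ≤ π * m * J := mul_nonneg (mul_nonneg pi_pos.le hm) hJ0
  have u2 := mul_le_mul_of_nonneg_left t2 u0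
  have u3 := mul_le_mul_of_nonneg_left t3 hCg
  have u3' := mul_le_mul_of_nonneg_right hπ1
    (by positivity : (0:ℝ) ≤ Cg * (s * ((1 + s) * (1 + Real.log (1 + s)))))
  have u4 := mul_le_mul_of_nonneg_left t1 (by positivity : (0:ℝ) ≤ 3 * π / 2)
  have hsum : |gainTerm (fun x : EuclideanSpace ℝ (Fin 3) => F ‖x‖) v -
      lorentzGain (fun x : EuclideanSpace ℝ (Fin 3) => F ‖x‖) v| +
      |lossTerm (fun x : EuclideanSpace ℝ (Fin 3) => F ‖x‖) v| + |G| + (collisionFrequency v - π * s) * |F s| ≤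
      π * s * (((5638 + J) * m + Cg) * ((1 + s) * (1 + Real.log (1 + s)))) := by
    linarith only [hA, hB, hG, hD, u0, u1, u2, u3, u3', u4]
  have hπs : 0 < π * s := by positivity
  have h := hdef.trans hsum
  rw [abs_mul, abs_of_pos hπs] at h
  exact le_of_mul_le_mul_left h hπs

/-- **Registered helper `t12_zonal_round1` — round 1 of the `ℓ = 0` bootstrap.** Under the hypotheses of `abs_zonalEulerDefect_le_linLog` at every
`s ≥ 1` and continuity of `F`, the lin-log Euler lemma `t12_euler_zonal_linLogGrowth` (`a = 0`, `s₀ = 1`)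
yields `q₁` with `|q₁| ≤ 16m + 32Γ₁` and the GLOBAL lin-log remainder
`|F(t) - q₁t²| ≤ (9Γ₁ + 4m + |q₁|)(1+t)(1+log(1+t))` for `t ≥ 0` (`|F| ≤ 4m` on `[0, 1]`). [folklore] -/
theorem t12_zonal_round1 : ∀ (F G : ℝ → ℝ) (e : Metric.sphere (0 : EuclideanSpace ℝ (Fin 3)) 1) (m Cg : ℝ), Continuous F → (∀ t, |F t| ≤ m * (1 + t ^ 2) * (1 + Real.log (1 + t ^ 2))) → (∀ φ ∈ Literature.Analysis.UnboundedOperators.collisionInvariants (EuclideanSpace ℝ (Fin 3)), Literature.Analysis.UnboundedOperators.maxwellianInner (fun x : EuclideanSpace ℝ (Fin 3) => F ‖x‖) φ = 0) → 0 ≤ Cg → (∀ s, 1 ≤ s → |G s| ≤ Cg * (1 + s ^ 2)) → (∀ s, 1 ≤ s → Literature.Analysis.UnboundedOperators.collisionFrequency (s • (e : EuclideanSpace ℝ (Fin 3))) * F s = Summit.AtomisticToContinuum.HydrodynamicLimit.Theorems.ClampedCorrectorBirth.gainTerm (fun x : EuclideanSpace ℝ (Fin 3) => F ‖x‖) (s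 • (e : EuclideanSpace ℝ (Fin 3))) - Summit.AtomisticToContinuum.HydrodynamicLimit.Theorems.ClampedCorrectorBirth.lossTerm (fun x : EuclideanSpace ℝ (Fin 3) => F ‖x‖) (s • (e : EuclideanSpace ℝ (Fin 3))) - G s) → ∃ q₁ : ℝ, |q₁| ≤ 16 * m + 32 * ((5638 + ∫ w, (1 + ‖w‖) ^ 6 ∂ProbabilityTheory.stdGaussian (EuclideanSpace ℝ (Fin 3))) * m + Cg) ∧ ∀ t, 0 ≤ t → |F t - q₁ * t ^ 2| ≤ (9 * ((5638 + ∫ w, (1 + ‖w‖) ^ 6 ∂ProbabilityTheory.stdGaussian (EuclideanSpace ℝ (Fin 3))) * m + Cg) + 4 * m + |q₁|) * ((1 + t) * (1 + Real.log (1 + t))) := by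
  intro F G e m Cg hFc hFW horth hCg hG hS
  have hδ : ∀ s, 1 ≤ s → |4 / s ^ 2 * (∫ t in (0:ℝ)..s, t * F t) - F s| ≤
      ((5638 + ∫ w, (1 + ‖w‖) ^ 6 ∂stdGaussian (EuclideanSpace ℝ (Fin 3))) * m + Cg) *
        ((1 + s) * (1 + Real.log (1 + s))) :=
    fun s hs => abs_zonalEulerDefect_le_linLog hFc.measurable hFW horth e hCg hs (hG s hs) (hS s hs)
  obtain ⟨J, hJ0, hJ⟩ : ∃ J : ℝ, 0 ≤ J ∧ (∫ w, (1 + ‖w‖) ^ 6 ∂stdGaussian (EuclideanSpace ℝ (Fin 3))) = J :=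
    ⟨_, integral_nonneg fun w => by positivity, rfl⟩
  rw [hJ] at hδ ⊢
  obtain ⟨hm, -, -, h4m⟩ := zonalProfile_apriori hFW
  have hΓ0 : 0 ≤ (5638 + J) * m + Cg := by positivity
  have hE : ∀ s, (1:ℝ) ≤ s → F s = 4 / s ^ 2 * (∫ t in (0:ℝ)..s, t * F t) -
      (0 * s + (4 / s ^ 2 * (∫ t in (0:ℝ)..s, t * F t) - F s)) := fun s _ => by ring
  obtain ⟨q₁, hq, hrem⟩ := t12_euler_zonal_linLogGrowth F
    (fun s => 4 / s ^ 2 * (∫ t in (0:ℝ)..s, t * F t) - F s) 0 ((5638 + J) * m + Cg) 1 one_pos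
    hFc.continuousOn ((continuous_id.mul hFc).intervalIntegrable 0 1) hδ hE
  have hI := abs_firstMoment_one_le_of_quadLog hFW
  have hlog2 : Real.log 2 ≤ 1 := by have := Real.log_le_sub_one_of_pos two_pos; linarith
  simp only [one_pow, div_one, sub_zero, one_add_one_eq_two] at hq
  have hq₁ : |q₁| ≤ 16 * m + 32 * ((5638 + J) * m + Cg) := by
    have h1 : |q₁| ≤ |q₁ - 4 * ∫ t in (0:ℝ)..1, t * F t| + |4 * ∫ t in (0:ℝ)..1, t * F t| := by
      have := abs_add_le (q₁ - 4 * ∫ t in (0:ℝ)..1, t * F t) (4 * ∫ t in (0:ℝ)..1, t * F t)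
      rwa [sub_add_cancel] at this
    rw [abs_mul, show |(4:ℝ)| = 4 by norm_num] at h1
    have h2 : 8 * ((5638 + J) * m + Cg) * (2 * (1 + Real.log 2)) ≤ 32 * ((5638 + J) * m + Cg) := by
      nlinarith only [hlog2, hΓ0]
    linarith only [h1, h2, hq, hI]
  refine ⟨q₁, hq₁, fun t ht => ?_⟩
  obtain ⟨hw1, hw0⟩ := one_add_le_linLog ht
  rcases le_or_gt 1 t with ht1 | ht1
  · have h := hrem t ht1
    simp only [mul_zero, zero_mul, sub_zero] at h
    refine h.trans (mul_le_mul_of_nonneg_right ?_ (by positivity))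
    linarith only [abs_nonneg q₁, hm]
  · have h1 : |F t - q₁ * t ^ 2| ≤ 4 * m + |q₁| := by
      have ht2 : t ^ 2 ≤ 1 := by nlinarith only [ht, ht1]
      calc |F t - q₁ * t ^ 2| ≤ |F t| + |q₁ * t ^ 2| := abs_sub _ _
        _ ≤ 4 * m + |q₁| * 1 := by
            rw [abs_mul, abs_of_nonneg (sq_nonneg t)]
            exact add_le_add (h4m t ht ht1.le) (mul_le_mul_of_nonneg_left ht2 (abs_nonneg _))
        _ = 4 * m + |q₁| := by ring
    calc |F t - q₁ * t ^ 2| ≤ (4 * m + |q₁|) * 1 := by linarith only [h1]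
      _ ≤ (9 * ((5638 + J) * m + Cg) + 4 * m + |q₁|) * ((1 + t) * (1 + Real.log (1 + t))) :=
          mul_le_mul (by linarith only [hΓ0]) hw0 zero_le_one (by positivity)

end Summit.AtomisticToContinuum.HydrodynamicLimit.Theorems.ClampedCorrectorBirth

end
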